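import Mathlib.Topology.UniformSpace.CompactConvergence
import Mathlib.Topology.Algebra.Group.Basic
import Mathlib.Analysis.Complex.Basic
import Mathlib.RepresentationTheory.Basic
import Literature.NumberTheory.Weil1964.ThetaKernelDualPair
import Literature.NumberTheory.Weil1964.ThetaSeriesProduct
import HarnessLib

/-!
# The theta-initial topology on `S(X_A)`: Weil's continuity statements n° 39 / p. 194 as theorems

Topic `NumberTheory/Weil1964`; namespace `Literature.NumberTheory.Weil1964.WeilThetaDatum` (continues
`ThetaDistribution`, `ThetaKernelDualPair`).

[Weil1964, Chap. III] works with the Schwartz–Bruhat space `S(X_A)` in its inductive-limit topology (n° 29)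
and proves: n° 39 p. 189 — `(S, Φ) ↦ SΦ` is jointly continuous `Mp(X)_A × S(X_A) → S(X_A)`; n° 41
Théorème 6 p. 193 — `S ↦ Θ_Φ(S) = Σ_{ξ ∈ X_k} (SΦ)(ξ)` is continuous on `Mp(X)_A` for each `Φ`; p. 194 —
the theta distribution `Φ ↦ Θ_Φ(1)` is continuous.  The tree's hypothesis structures record these as the
fields `actionContinuous` / `thetaContinuousInvariant` / `dist_cont` of `ThetaKernelDatum` over a carrier
type `SX` WITH a topology.  The harness tree has no inductive-limit topology on its Schwartz–Bruhat carrier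
(`piSchwartzBruhat`), so these two fields cannot be inhabited there as stated.

## What this file provides (kernel only; no `Prop` records, no print hypotheses)

For ANY datum `D : WeilThetaDatum Mp SX` on a BARE carrier type `SX`:
* §1 the THETA-INITIAL TOPOLOGY `D.thetaTopology` on `SX` — the initial topology of
  `Φ ↦ Θ_Φ : SX → (Mp → ℂ)` for the topology of compact convergence (`UniformOnFun`), i.e. the coarsest
  topology on `S(X_A)` for which `Φ ↦ Θ_Φ ∈ C(Mp(X)_A)` is continuous — and the type synonym
  `D.ThetaTop` carrying it (and inheriting the additive / module structure of `SX`, so that linearity of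
  `Φ ↦ Θ_Φ` can be stated on it), with the datum re-read on it (`D.onThetaTop`, definitionally `D`);
* §2 under Théorème 6 conjunct 1 PER `Φ` (`∀ Φ, Continuous (D.theta Φ)`): continuity of
  `Φ ↦ Θ_Φ ∈ C(Mp, ℂ)` (`continuous_thetaCM`), of `Φ ↦ Θ_Φ(S)` (`continuous_theta_apply`; `S = 1`:
  `dist_cont_thetaTop`, the p. 194 statement), and — for `Mp` LOCALLY COMPACT — joint continuity of
  `(Φ, S) ↦ Θ_Φ(S)` (`continuous_theta_uncurry`);
* §3 for `Mp` a locally compact topological group with `Θ_{S'Φ}(S) = Θ_Φ(S S')` (`theta_act`): JOINT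
  CONTINUITY OF THE ACTION `Mp × S(X_A) → S(X_A)` in the theta-initial topology
  (`actionContinuous_thetaTop`, the n° 39 statement) — because `Θ_{S₀Φ} = Θ_Φ ∘ r_{S₀}` and composition
  `C(Mp, Mp) × C(Mp, ℂ) → C(Mp, ℂ)` is continuous for locally compact `Mp`;
* §4 the constructor `ThetaKernelDatum.ofThetaContinuous`: a theta-kernel datum over `D.ThetaTop` from
  `act_one`, `theta_act`, Théorème 6 (`ThetaContinuousInvariant`, per `Φ`), a continuous splitting `s` with
  `s(ΓU × Γ) ⊂ r_k(Ps(X)_k)` and an `s(1 × G)`-stable index set — NO topology on `S(X_A)` and no n° 39 /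
  p. 194 input required; all kernel laws of `ThetaKernelDualPair` / `ThetaLift` then apply to it;
* §5 the JUNCTION RECIPE `WeilThetaDatum.ofAction` / `ThetaKernelDatum.ofAction`: the same from an ACTION
  `act : Mp → SX → SX` with unit and multiplication laws and a DISTRIBUTION `Θ : SX → ℂ`
  (`Θ_Φ(S) := Θ(SΦ)`), continuity of `S ↦ Θ(SΦ)` per `Φ`, and invariance `Θ(r_k(s)Φ) = Θ(Φ)` — the form
  in which the constructed adelic Weil representation and theta distribution are delivered — with the
  adapter `ThetaKernelDatum.ofRepresentation` for a Mathlib `Representation k Mp SX`.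

The theta-initial topology is coarser than Weil's (n° 39 and Théorème 6 make `Φ ↦ Θ_Φ` continuous for the
inductive-limit topology), so `dist_cont` for it is the STRONGER statement and every continuity-in-`Φ`
consequence downstream (`continuous_thetaKer`, `continuous_thetaLift_left`) holds a fortiori.

## References

* [Weil1964] A. Weil, *Sur certains groupes d'opérateurs unitaires*, Acta Math. 111 (1964) 143–211,
  doi:10.1007/BF02391012 — n° 29 p. 176 (topology of `S(X_A)`), n° 39 p. 189, n° 41 Théorème 6 p. 193,
  p. 194.
* [Bourbaki, TG X §3 n° 4 Prop. 9] continuity of composition for the compact-open topology (Mathlib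
  `ContinuousMap.continuous_comp'`).
-/

open _root_.Topology Set Filter Function
open scoped UniformConvergence

namespace Literature.NumberTheory.Weil1964

namespace WeilThetaDatum

universe u v

variable {Mp : Type u} {SX : Type v}

/-! ## 1. The theta-initial topology -/

/-- **`S(X_A)` with the theta-initial topology** (type synonym of the carrier `SX`; the topology is the
instance `instTopologicalSpaceThetaTop` below). [folklore] -/
@[nolint unusedArguments]
def ThetaTop (_D : WeilThetaDatum Mp SX) : Type v := SX

variable (D : WeilThetaDatum Mp SX)

/-- `D.ThetaTop` inherits the additive structure of `S(X_A)`. [folklore] -/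
instance instAddCommMonoidThetaTop [h : AddCommMonoid SX] : AddCommMonoid D.ThetaTop := h

/-- `D.ThetaTop` inherits the additive group structure of `S(X_A)`. [folklore] -/
instance instAddCommGroupThetaTop [h : AddCommGroup SX] : AddCommGroup D.ThetaTop := h

/-- `D.ThetaTop` inherits the module structure of `S(X_A)` (any scalars). [folklore] -/
instance instModuleThetaTop {R : Type*} [Semiring R] [AddCommMonoid SX] [h : Module R SX] :
    Module R D.ThetaTop := h

/-- The identification `S(X_A) ≃ D.ThetaTop` (identity on elements). [folklore] -/
def toThetaTop : SX ≃ D.ThetaTop := Equiv.refl SX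

/-- The same datum, read on the carrier `D.ThetaTop` (definitionally `D`). [folklore] -/
def onThetaTop : WeilThetaDatum Mp D.ThetaTop where
  act := D.act
  rat := D.rat
  theta := D.theta

/-- The action of `D.onThetaTop` is that of `D`. [folklore] -/
@[simp] theorem onThetaTop_act : D.onThetaTop.act = D.act := rfl

/-- The rational subset of `D.onThetaTop` is that of `D`. [folklore] -/
@[simp] theorem onThetaTop_rat : D.onThetaTop.rat = D.rat := rfl

/-- The theta function of `D.onThetaTop` is that of `D`. [folklore] -/
@[simp] theorem onThetaTop_theta : D.onThetaTop.theta = D.theta := rfl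

variable [TopologicalSpace Mp]

/-- **The theta-initial topology on `S(X_A)`**: the initial topology of `Φ ↦ Θ_Φ : SX → (Mp → ℂ)` for
the topology of uniform convergence on compact subsets of `Mp(X)_A` — the coarsest topology making
`Φ ↦ Θ_Φ ∈ C(Mp(X)_A)` continuous. [folklore] -/
noncomputable instance instTopologicalSpaceThetaTop : TopologicalSpace D.ThetaTop :=
  .induced (fun Φ : SX => UniformOnFun.ofFun {K : Set Mp | IsCompact K} (D.theta Φ))
    (UniformOnFun.topologicalSpace Mp ℂ {K : Set Mp | IsCompact K})

/-- The defining map `Φ ↦ Θ_Φ` into `Mp →ᵤ[compacts] ℂ` is continuous on `D.ThetaTop`. [folklore] -/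
theorem continuous_theta_uniformOnFun :
    Continuous fun Φ : D.ThetaTop => UniformOnFun.ofFun {K : Set Mp | IsCompact K} (D.theta Φ) :=
  continuous_induced_dom

/-- Universal property: a map into `D.ThetaTop` is continuous iff its composite with
`Φ ↦ Θ_Φ ∈ Mp →ᵤ[compacts] ℂ` is. [folklore] -/
theorem continuous_rng_iff {Y : Type*} [TopologicalSpace Y] {f : Y → D.ThetaTop} :
    Continuous f ↔
      Continuous fun y => UniformOnFun.ofFun {K : Set Mp | IsCompact K} (D.theta (f y)) :=
  continuous_induced_rng

/-! ## 2. Continuity of `Φ ↦ Θ_Φ` and of the theta distribution -/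

section ThetaContinuous

variable (hΘ : ∀ Φ : SX, Continuous (D.theta Φ))
include hΘ

/-- `Θ_Φ` as an element of `C(Mp, ℂ)` (Théorème 6, conjunct 1, per `Φ`). [folklore] -/
def thetaCM (Φ : D.ThetaTop) : C(Mp, ℂ) := ⟨D.theta Φ, hΘ Φ⟩

/-- `thetaCM` evaluates to `Θ_Φ(S)`. [folklore] -/
@[simp] theorem thetaCM_apply (Φ : D.ThetaTop) (S : Mp) : D.thetaCM hΘ Φ S = D.theta Φ S := rfl

/-- **`Φ ↦ Θ_Φ ∈ C(Mp(X)_A, ℂ)` is continuous** for the theta-initial topology (compact-open topology on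
the target). [folklore] -/
theorem continuous_thetaCM : Continuous (D.thetaCM hΘ) :=
  (ContinuousMap.continuous_iff_continuous_uniformOnFun _).2 (D.continuous_theta_uniformOnFun)

/-- `Φ ↦ Θ_Φ(S)` is continuous for every `S`. [folklore] -/
theorem continuous_theta_apply (S : Mp) : Continuous fun Φ : D.ThetaTop => D.theta Φ S :=
  (continuous_eval_const (F := C(Mp, ℂ)) S).comp (D.continuous_thetaCM hΘ)

/-- **Continuity of the theta distribution `Φ ↦ Θ_Φ(1)`** ([Weil1964, p. 194]) for the theta-initial
topology — the `dist_cont` field of `ThetaKernelDatum`, as a theorem. [folklore] -/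
theorem dist_cont_thetaTop [One Mp] : Continuous fun Φ : D.ThetaTop => D.onThetaTop.theta Φ 1 :=
  D.continuous_theta_apply hΘ 1

/-- Joint continuity of `(Φ, S) ↦ Θ_Φ(S)` on `D.ThetaTop × Mp` for locally compact `Mp`. [folklore] -/
theorem continuous_theta_uncurry [LocallyCompactSpace Mp] :
    Continuous fun p : D.ThetaTop × Mp => D.theta p.1 p.2 :=
  (ContinuousEval.continuous_eval (F := C(Mp, ℂ))).comp ((D.continuous_thetaCM hΘ).prodMap continuous_id)

end ThetaContinuous

/-! ## 3. Joint continuity of the action (n° 39) in the theta-initial topology -/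

section Action

variable [Group Mp] [ContinuousMul Mp]

/-- Right multiplication `r_{S₀} : S ↦ S S₀` as a continuous family in `C(Mp, Mp)`. [folklore] -/
def mulRightCM : C(Mp, C(Mp, Mp)) :=
  ContinuousMap.curry ⟨fun p : Mp × Mp => p.2 * p.1, continuous_snd.mul continuous_fst⟩

/-- `mulRightCM S₀ S = S S₀`. [folklore] -/
@[simp] theorem mulRightCM_apply (S₀ S : Mp) : mulRightCM S₀ S = S * S₀ := rfl

variable (hΘ : ∀ Φ : SX, Continuous (D.theta Φ))
  (hact : ∀ (Φ : SX) (S S' : Mp), D.theta (D.act S' Φ) S = D.theta Φ (S * S'))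
include hΘ hact

/-- `Θ_{S₀Φ} = Θ_Φ ∘ r_{S₀}` in `C(Mp, ℂ)`. [folklore] -/
theorem thetaCM_act (S₀ : Mp) (Φ : D.ThetaTop) :
    D.thetaCM hΘ (D.act S₀ Φ) = (D.thetaCM hΘ Φ).comp (mulRightCM S₀) := by
  ext S
  simp only [thetaCM_apply, ContinuousMap.comp_apply, mulRightCM_apply, hact]

/-- Each `S₀ ∈ Mp(X)_A` acts continuously on `S(X_A)` in the theta-initial topology. [folklore] -/
theorem continuous_act_const (S₀ : Mp) : Continuous (D.onThetaTop.act S₀) := by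
  rw [continuous_rng_iff]
  have h : Continuous fun Φ : D.ThetaTop => (D.thetaCM hΘ Φ).comp (mulRightCM S₀) :=
    (ContinuousMap.continuous_precomp _).comp (D.continuous_thetaCM hΘ)
  have h' := (ContinuousMap.continuous_iff_continuous_uniformOnFun _).1 h
  refine h'.congr fun Φ => ?_
  rw [← D.thetaCM_act hΘ hact]
  rfl

variable [LocallyCompactSpace Mp]

/-- **Joint continuity of the action `Mp(X)_A × S(X_A) → S(X_A)`** ([Weil1964, n° 39, p. 189]) for the
theta-initial topology — the `actionContinuous` field of `ThetaKernelDatum`, as a theorem: by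
`Θ_{S₀Φ} = Θ_Φ ∘ r_{S₀}` and the continuity of composition `C(Mp, Mp) × C(Mp, ℂ) → C(Mp, ℂ)` for locally
compact `Mp` [Bourbaki TG X §3 n° 4 Prop. 9]. [folklore] -/
theorem actionContinuous_thetaTop : D.onThetaTop.ActionContinuous := by
  unfold WeilThetaDatum.ActionContinuous
  rw [continuous_rng_iff]
  have h : Continuous fun p : Mp × D.ThetaTop => (D.thetaCM hΘ p.2).comp (mulRightCM p.1) :=
    ContinuousMap.continuous_comp'.comp
      (mulRightCM.continuous.prodMap (D.continuous_thetaCM hΘ))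
  have h' := (ContinuousMap.continuous_iff_continuous_uniformOnFun _).1 h
  refine h'.congr fun p => ?_
  rw [← D.thetaCM_act hΘ hact]
  rfl

end Action

end WeilThetaDatum

/-! ## 4. A theta-kernel datum with no topology on `S(X_A)` -/

namespace ThetaKernelDatum

universe u v

variable {Mp : Type u} {SX : Type v} [TopologicalSpace Mp] [Group Mp] [ContinuousMul Mp]
  [LocallyCompactSpace Mp]
variable {GU : Type*} [Group GU] [TopologicalSpace GU] {ΓU : Subgroup GU}
variable {G : Type*} [Group G] [TopologicalSpace G] {Γ : Subgroup G}

/-- **A theta-kernel datum over the theta-initial topology.**  From a Weil theta datum `W` on a BARE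
carrier `S(X_A)` over a locally compact topological group `Mp(X)_A`, the unit law, `Θ_{S'Φ}(S) = Θ_Φ(SS')`,
[Weil1964, n° 41 Théorème 6] (continuity and left `r_k(Ps(X)_k)`-invariance of each `Θ_Φ`), a continuous
dual-pair splitting `s : GU × G → Mp(X)_A` carrying `ΓU × Γ` into `r_k(Ps(X)_k)`, and an `s(1 × G)`-stable
index set: the datum of `ThetaKernelDualPair` on the carrier `W.ThetaTop`, whose `actionContinuous`
(n° 39) and `dist_cont` (p. 194) fields are THEOREMS (`actionContinuous_thetaTop`, `dist_cont_thetaTop`).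
[folklore] -/
def ofThetaContinuous (W : WeilThetaDatum Mp SX) (act_one : ∀ Φ : SX, W.act 1 Φ = Φ)
    (theta_act : ∀ (Φ : SX) (S S' : Mp), W.theta (W.act S' Φ) S = W.theta Φ (S * S'))
    (hΘ : W.ThetaContinuousInvariant) (s : GU × G →* Mp) (s_cont : Continuous s)
    (s_rat : ∀ γU ∈ ΓU, ∀ γ ∈ Γ, s (γU, γ) ∈ W.rat) (SK : Set SX)
    (SK_stable : ∀ (h : G) (Φ : SX), Φ ∈ SK → W.act (s (1, h)) Φ ∈ SK) :
    ThetaKernelDatum Mp W.ThetaTop GU ΓU G Γ where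
  W := W.onThetaTop
  act_one := act_one
  theta_act := theta_act
  actionContinuous := W.actionContinuous_thetaTop hΘ.1 theta_act
  thetaContinuousInvariant := hΘ
  dist_cont := W.dist_cont_thetaTop hΘ.1
  s := s
  s_cont := s_cont
  s_rat := s_rat
  SK := SK
  SK_stable := SK_stable

section

variable (W : WeilThetaDatum Mp SX) (act_one : ∀ Φ : SX, W.act 1 Φ = Φ)
  (theta_act : ∀ (Φ : SX) (S S' : Mp), W.theta (W.act S' Φ) S = W.theta Φ (S * S'))
  (hΘ : W.ThetaContinuousInvariant) (s : GU × G →* Mp) (s_cont : Continuous s)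
  (s_rat : ∀ γU ∈ ΓU, ∀ γ ∈ Γ, s (γU, γ) ∈ W.rat) (SK : Set SX)
  (SK_stable : ∀ (h : G) (Φ : SX), Φ ∈ SK → W.act (s (1, h)) Φ ∈ SK)

/-- The Weil datum of `ofThetaContinuous` is `W.onThetaTop`. [folklore] -/
@[simp] theorem ofThetaContinuous_W :
    (ofThetaContinuous W act_one theta_act hΘ s s_cont s_rat SK SK_stable :
      ThetaKernelDatum Mp W.ThetaTop GU ΓU G Γ).W = W.onThetaTop := rfl

/-- The splitting of `ofThetaContinuous` is `s`. [folklore] -/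
@[simp] theorem ofThetaContinuous_s :
    (ofThetaContinuous W act_one theta_act hΘ s s_cont s_rat SK SK_stable :
      ThetaKernelDatum Mp W.ThetaTop GU ΓU G Γ).s = s := rfl

/-- The index set of `ofThetaContinuous` is `SK`. [folklore] -/
@[simp] theorem ofThetaContinuous_SK :
    (ofThetaContinuous W act_one theta_act hΘ s s_cont s_rat SK SK_stable :
      ThetaKernelDatum Mp W.ThetaTop GU ΓU G Γ).SK = SK := rfl

/-- The kernel of the constructed datum on representatives is Weil's: `θ_Φ(x, y) = Θ_Φ(s(x, y)⁻¹)`.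
[folklore] -/
theorem ofThetaContinuous_thetaFun (Φ : SX) (p : GU × G) :
    (ofThetaContinuous W act_one theta_act hΘ s s_cont s_rat SK SK_stable :
      ThetaKernelDatum Mp W.ThetaTop GU ΓU G Γ).thetaFun Φ p = W.theta Φ (s p⁻¹) := rfl

end

end ThetaKernelDatum

/-! ## 5. The junction recipe: from an action, an invariant distribution and a splitting -/

namespace WeilThetaDatum

universe u' v'

variable {Mp : Type u'} {SX : Type v'}

/-- **Weil theta datum of an action and a distribution**: `SΦ := act S Φ`, `rat`, and
`Θ_Φ(S) := Θ(SΦ)` for a functional `Θ : S(X_A) → ℂ` (in [Weil1964, n° 41] `Θ(Φ) = Σ_{ξ ∈ X_k} Φ(ξ)`,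
so that `Θ(S) = Σ_ξ (SΦ)(ξ) = Θ(SΦ)`). [folklore] -/
def ofAction (act : Mp → SX → SX) (rat : Set Mp) (dist : SX → ℂ) : WeilThetaDatum Mp SX where
  act := act
  rat := rat
  theta Φ S := dist (act S Φ)

section

variable (act : Mp → SX → SX) (rat : Set Mp) (dist : SX → ℂ)

/-- The action of `ofAction` is `act`. [folklore] -/
@[simp] theorem ofAction_act : (ofAction act rat dist).act = act := rfl

/-- The rational subset of `ofAction` is `rat`. [folklore] -/
@[simp] theorem ofAction_rat : (ofAction act rat dist).rat = rat := rfl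

/-- `Θ_Φ(S) = Θ(SΦ)` for `ofAction`. [folklore] -/
@[simp] theorem ofAction_theta (Φ : SX) (S : Mp) : (ofAction act rat dist).theta Φ S = dist (act S Φ) := rfl

/-- `Θ_{S'Φ}(S) = Θ_Φ(SS')` for a multiplicative action. [folklore] -/
theorem ofAction_theta_act [Mul Mp] (hmul : ∀ (S S' : Mp) (Φ : SX), act (S * S') Φ = act S (act S' Φ))
    (Φ : SX) (S S' : Mp) :
    (ofAction act rat dist).theta ((ofAction act rat dist).act S' Φ) S =
      (ofAction act rat dist).theta Φ (S * S') := by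
  simp [hmul]

/-- [Weil1964, n° 41 Théorème 6] for the datum of an action: continuity of `S ↦ Θ(SΦ)` for each `Φ`, and
invariance `Θ(r_k(s) S Φ) = Θ(SΦ)` from the invariance of the distribution `Θ ∘ r_k(s) = Θ` (Poisson
summation, [Weil1964, n° 41, p. 193, formula (34)]) and multiplicativity of the action. [folklore] -/
theorem ofAction_thetaContinuousInvariant [TopologicalSpace Mp] [Group Mp]
    (hmul : ∀ (S S' : Mp) (Φ : SX), act (S * S') Φ = act S (act S' Φ))
    (hc : ∀ Φ : SX, Continuous fun S : Mp => dist (act S Φ))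
    (hinv : ∀ γ ∈ rat, ∀ Φ : SX, dist (act γ Φ) = dist Φ) :
    (ofAction act rat dist).ThetaContinuousInvariant := by
  refine ⟨hc, fun Φ γ hγ S => ?_⟩
  simp [hmul, hinv γ hγ]

end

end WeilThetaDatum

/-- The tree's theta-SERIES packaging (`ThetaSeriesProduct`: `Θ_Φ(S) = Σ_{ξ ∈ X_k} (SΦ)(ξ)` as a `tsum` over an
evaluation model) IS the junction datum of its action and the distribution `Φ ↦ Σ_ξ Φ(ξ)` — so the seesaw /
product shells stated over `toWeilThetaDatum` (e.g. `HarrisKudlaSweet1996.SeesawThetaKernels`) live on the same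
`ThetaTop`. [folklore] -/
theorem ThetaSeriesDatum.toWeilThetaDatum_eq_ofAction {Mp : Type*} {SX : Type*} {Xk : Type*}
    (D : ThetaSeriesDatum Mp SX Xk) (rat : Set Mp) :
    D.toWeilThetaDatum rat = WeilThetaDatum.ofAction D.act rat (fun Φ => ∑' ξ : Xk, D.ev Φ ξ) := rfl

namespace ThetaKernelDatum

universe u' v'

variable {Mp : Type u'} {SX : Type v'} [TopologicalSpace Mp] [Group Mp] [ContinuousMul Mp]
  [LocallyCompactSpace Mp]
variable {GU : Type*} [Group GU] [TopologicalSpace GU] {ΓU : Subgroup GU}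
variable {G : Type*} [Group G] [TopologicalSpace G] {Γ : Subgroup G}

/-- **THE JUNCTION RECIPE (theta-kernel datum from constructed pieces).**  Inputs, each a kernel object or a
kernel theorem about constructed objects: an action `act` of the locally compact group `Mp(X)_A` on the bare
carrier `S(X_A)` with its unit and multiplication laws; a functional `Θ : S(X_A) → ℂ`; continuity of
`S ↦ Θ(SΦ)` for each `Φ` and invariance `Θ(r_k(s)Φ) = Θ(Φ)` ([Weil1964, Théorème 6] for these objects); a
continuous dual-pair splitting `s : GU × G → Mp(X)_A` with `s(ΓU × Γ) ⊂ r_k(Ps(X)_k)`; an `s(1 × G)`-stable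
index set.  Output: a `ThetaKernelDatum` over the theta-initial topology, to which every kernel law of
`ThetaKernelDualPair` / `ThetaLift` applies; NO topology on `S(X_A)`, NO n° 39, NO p. 194 input. [folklore] -/
def ofAction (act : Mp → SX → SX) (rat : Set Mp) (dist : SX → ℂ) (act_one : ∀ Φ : SX, act 1 Φ = Φ)
    (act_mul : ∀ (S S' : Mp) (Φ : SX), act (S * S') Φ = act S (act S' Φ))
    (hc : ∀ Φ : SX, Continuous fun S : Mp => dist (act S Φ))
    (hinv : ∀ γ ∈ rat, ∀ Φ : SX, dist (act γ Φ) = dist Φ) (s : GU × G →* Mp) (s_cont : Continuous s)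
    (s_rat : ∀ γU ∈ ΓU, ∀ γ ∈ Γ, s (γU, γ) ∈ rat) (SK : Set SX)
    (SK_stable : ∀ (h : G) (Φ : SX), Φ ∈ SK → act (s (1, h)) Φ ∈ SK) :
    ThetaKernelDatum Mp (WeilThetaDatum.ofAction act rat dist).ThetaTop GU ΓU G Γ :=
  ofThetaContinuous (WeilThetaDatum.ofAction act rat dist) act_one
    (WeilThetaDatum.ofAction_theta_act act rat dist act_mul)
    (WeilThetaDatum.ofAction_thetaContinuousInvariant act rat dist act_mul hc hinv) s s_cont s_rat SK
    SK_stable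

section

variable (act : Mp → SX → SX) (rat : Set Mp) (dist : SX → ℂ) (act_one : ∀ Φ : SX, act 1 Φ = Φ)
  (act_mul : ∀ (S S' : Mp) (Φ : SX), act (S * S') Φ = act S (act S' Φ))
  (hc : ∀ Φ : SX, Continuous fun S : Mp => dist (act S Φ))
  (hinv : ∀ γ ∈ rat, ∀ Φ : SX, dist (act γ Φ) = dist Φ) (s : GU × G →* Mp) (s_cont : Continuous s)
  (s_rat : ∀ γU ∈ ΓU, ∀ γ ∈ Γ, s (γU, γ) ∈ rat) (SK : Set SX)
  (SK_stable : ∀ (h : G) (Φ : SX), Φ ∈ SK → act (s (1, h)) Φ ∈ SK)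

/-- The splitting of the junction datum is `s`. [folklore] -/
@[simp] theorem ofAction_s :
    (ofAction act rat dist act_one act_mul hc hinv s s_cont s_rat SK SK_stable :
      ThetaKernelDatum Mp _ GU ΓU G Γ).s = s := rfl

/-- The index set of the junction datum is `SK`. [folklore] -/
@[simp] theorem ofAction_SK :
    (ofAction act rat dist act_one act_mul hc hinv s s_cont s_rat SK SK_stable :
      ThetaKernelDatum Mp _ GU ΓU G Γ).SK = SK := rfl

/-- Weil's kernel for the junction datum: `θ_Φ(x, y) = Θ(s(x, y)⁻¹ Φ)`. [folklore] -/
theorem ofAction_thetaFun (Φ : SX) (p : GU × G) :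
    (ofAction act rat dist act_one act_mul hc hinv s s_cont s_rat SK SK_stable :
      ThetaKernelDatum Mp _ GU ΓU G Γ).thetaFun Φ p = dist (act (s p⁻¹) Φ) := rfl

/-- … and on the unitary variable at a fixed `h ∈ G`: `θ_Φ(x, h) = Θ(s(x⁻¹, h⁻¹) Φ)`. [folklore] -/
theorem ofAction_thetaFun_mk (Φ : SX) (x : GU) (h : G) :
    (ofAction act rat dist act_one act_mul hc hinv s s_cont s_rat SK SK_stable :
      ThetaKernelDatum Mp _ GU ΓU G Γ).thetaFun Φ (x, h) = dist (act (s (x⁻¹, h⁻¹)) Φ) := rfl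

end

/-- **Adapter for a LINEAR representation** (the form `⊗′_v ω_v` is delivered in, as a Mathlib
`Representation`): the junction recipe with `act S Φ := π S Φ`; unit and multiplication laws are those of
`π`. [folklore] -/
def ofRepresentation {k : Type*} [CommSemiring k] [AddCommMonoid SX] [Module k SX]
    (π : Representation k Mp SX) (rat : Set Mp) (dist : SX → ℂ)
    (hc : ∀ Φ : SX, Continuous fun S : Mp => dist (π S Φ))
    (hinv : ∀ γ ∈ rat, ∀ Φ : SX, dist (π γ Φ) = dist Φ) (s : GU × G →* Mp) (s_cont : Continuous s)
    (s_rat : ∀ γU ∈ ΓU, ∀ γ ∈ Γ, s (γU, γ) ∈ rat) (SK : Set SX)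
    (SK_stable : ∀ (h : G) (Φ : SX), Φ ∈ SK → π (s (1, h)) Φ ∈ SK) :
    ThetaKernelDatum Mp (WeilThetaDatum.ofAction (fun S Φ => π S Φ) rat dist).ThetaTop GU ΓU G Γ :=
  ofAction (fun S Φ => π S Φ) rat dist (fun Φ => by simp) (fun S S' Φ => by simp) hc hinv s s_cont
    s_rat SK SK_stable

/-- Weil's kernel for the linear junction datum: `θ_Φ(x, h) = Θ(π(s(x⁻¹, h⁻¹)) Φ)`. [folklore] -/
theorem ofRepresentation_thetaFun_mk {k : Type*} [CommSemiring k] [AddCommMonoid SX] [Module k SX]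
    (π : Representation k Mp SX) (rat : Set Mp) (dist : SX → ℂ)
    (hc : ∀ Φ : SX, Continuous fun S : Mp => dist (π S Φ))
    (hinv : ∀ γ ∈ rat, ∀ Φ : SX, dist (π γ Φ) = dist Φ) (s : GU × G →* Mp) (s_cont : Continuous s)
    (s_rat : ∀ γU ∈ ΓU, ∀ γ ∈ Γ, s (γU, γ) ∈ rat) (SK : Set SX)
    (SK_stable : ∀ (h : G) (Φ : SX), Φ ∈ SK → π (s (1, h)) Φ ∈ SK) (Φ : SX) (x : GU) (h : G) :
    (ofRepresentation π rat dist hc hinv s s_cont s_rat SK SK_stable :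
      ThetaKernelDatum Mp _ GU ΓU G Γ).thetaFun Φ (x, h) = dist (π (s (x⁻¹, h⁻¹)) Φ) := rfl

end ThetaKernelDatum

end Literature.NumberTheory.Weil1964
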